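import Mathlib
import Literature.InformationTheory.Coding.TerwilligerAlgebraHamming
import Literature.InformationTheory.Coding.MaxCodeSize
import HarnessLib

/-!
# Schrijver's semidefinite programming bound for binary codes: the matrices `M'_C`, `M''_C`

Topic `Literature/InformationTheory/Coding`. The data of Schrijver's SDP bound for `A(n,d)`
[Schrijver2005], in the form given by Gijswijt [Gijswijt2010, Ch. 4 §2 (Prop. 24, 25, 26 and
Thm. 6), specialised to `q = 2`], on top of the Terwilliger-algebra skeleton of
`TerwilligerAlgebraHamming` (`orbitTriple`, `terwilligerIndex = 𝓘(2,n)`, `orbitMatrix = M^t_{i,j}`,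
and the transitivity theorem `exists_perm_map_eq_of_orbitTriple_eq`). Words of `{0,1}^n` are their
supports `I ⊆ [n]` (`Finset (Fin n)`), Hamming distance is `|I ∆ J|`, and the automorphism group of
the `n`-cube is parametrised by pairs `(z, π) ∈ 2^[n] × Sym(n)` acting by
`σ_{z,π} : I ↦ π(I) ∆ z` (`moveWord`). Everything is over `ℤ` in the *integer normalisation*
`|Aut| · M'` (no division by `|Aut| = 2^n n!`), which is what a certificate checker manipulates.

* `schrijverPos C I J = M'_C(I,J) = Σ_π Σ_z [z ∈ C][π(I) ∆ z ∈ C][π(J) ∆ z ∈ C]` — the number of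
  cube automorphisms `σ` with `∅, I, J ∈ σ(C)`; `schrijverAll C = M_C` (condition on `I, J` only)
  and `schrijverNeg C = M''_C` (`∅ ∉ σ(C)`), with `M = M' + M''` [Gijswijt2010, Ch. 4 §2, the
  matrices `M'`, `M''` and the proof of Prop. 24].
* **Positive semidefiniteness** `posSemidef_schrijverPosMatrix`, `posSemidef_schrijverNegMatrix`
  (`Matrix.PosSemidef` over `ℤ`; quadratic forms `quadForm_schrijverPos_nonneg`,
  `quadForm_schrijverNeg_nonneg`): both are nonnegative combinations of rank-one matrices
  `χ^{σC} (χ^{σC})ᵀ` [Gijswijt2010, Ch. 4 §2, paragraph before Thm. 6; Schrijver2005].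
* **`M'_C ∈ 𝓐_n`**: `schrijverPos_map_perm`, `schrijverPos_eq_of_orbitTriple_eq` (the entry depends
  only on `(|I|,|J|,|I ∩ J|)`, via the transitivity theorem), the orbit values
  `xcoeff C p = x_p` and `schrijverPosMatrix_eq_sum : M'_C = Σ_{p ∈ 𝓘(2,n)} x_p M_p`.
* **Prop. 24** (`q = 2`): `schrijverAll_eq_schrijverPos_empty : M_C(I,J) = M'_C(∅, I ∆ J)`
  (translation invariance: `M_C` lies in the Bose–Mesner algebra), hence
  `schrijverNeg_eq : M''_C(I,J) = M'_C(∅, I ∆ J) - M'_C(I,J)` and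
  `schrijverNegMatrix_eq_sum : M''_C = Σ_{(i,j,t)} (x_{(0,i+j-2t,0)} - x_{(i,j,t)}) M^t_{i,j}`.
* **Prop. 25** (`q = 2`, integer form): `sum_schrijverPos_orbit`, `orbitSize_mul_schrijverPos`:
  `γ_p · x_p = n! · λ_p(C)` where `λ_p(C) = tripleCount C p` counts the triples `(u,v,w) ∈ C³` with
  `(|u ∆ v|, |u ∆ w|, |(u ∆ v) ∩ (u ∆ w)|) = p` and `γ_p = orbitSize n p`.
* **Prop. 26** (`q = 2`): (i) `0 ≤ M'_C(I,J) ≤ M'_C(I,I) = M'_C(I,∅)` (`schrijverPos_nonneg`,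
  `schrijverPos_le_diag`, `schrijverPos_self`); (ii)
  `schrijverPos_reroot : M'_C(I,J) = M'_C(I, I ∆ J)` and `schrijverPos_comm` — invariance of
  `x^t_{i,j}` under the permutations of the triangle `(i, j, i+j-2t)`; (iii) vanishing when `|I|`,
  `|J|` or `|I ∆ J|` is a forbidden distance (`schrijverPos_eq_zero_of_card`,
  `schrijverPos_eq_zero_of_symmDiff`).
* **Thm. 6** (`q = 2`) in certificate form: the objective identities
  `sum_schrijverPos_empty : Σ_J M'_C(∅,J) = n! |C|²`,
  `schrijverPos_empty_empty : M'_C(∅,∅) = n! |C|`;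
  the constraint set `SchrijverFeasible n d x` (both PSD conditions stated with the matrices
  `Σ_p x_p M_p` and `Σ_p (x_{(0,i+j-2t,0)} - x_p) M_p`, the linear constraints (i)–(iii), all
  homogeneous); `schrijverFeasible_xcoeff` (every code of minimum distance `≥ d` gives a feasible
  point with objective `n!|C|²` and normalising coordinate `n!|C|`); and the bound
  `card_le_of_schrijverBound` / `maxCodeSize_le_of_schrijverBound`: **if
  `Σ_k C(n,k) x_{(0,k,0)} ≤ B · x_{(0,0,0)}` for every feasible `x`, then `A(n,d) ≤ B`** — a dual
  SDP solution is precisely a certificate of the hypothesis.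

Conventions. Pairs are rooted at `∅` in the FIRST coordinate: the orbit of `(∅, K)` is
`(0, |K|, 0)`, so Gijswijt's `x^{0,0}_{k,0}` is `x_{(0,k,0)}` here (equal to `x_{(k,0,0)}` by
`schrijverPos_comm`). The block diagonalisation (Laurent 2007 §2.2), needed to solve the SDP and
to check dual certificates in size polynomial in `n` rather than `2^n`, is not formalised here; the
statements below are the `2^n × 2^n` ("unreduced") form of the program.

References. [Schrijver2005] A. Schrijver, *New code upper bounds from the Terwilliger algebra and
semidefinite programming*, IEEE Trans. Inform. Theory 51 (2005) 2859–2866 (origin of `M'`, `M''`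
and of the bound; theorem numbers of that paper are not quoted here). [Gijswijt2010] D. Gijswijt,
*Matrix algebras and semidefinite programming techniques for codes*, PhD thesis (Amsterdam 2005),
arXiv:1007.0906, Ch. 4 §2: the matrices `M'`, `M''`, Prop. 24 (`M''` in the basis), Prop. 25
(`x = q^{-n} γ^{-1} λ`), Prop. 26 (linear constraints (i)–(iii)), Thm. 6 (the SDP bound on
`A_q(n,d)`) — proposition numbers as in the arXiv version. [Laurent2006] M. Laurent, *Strengthened
semidefinite programming bounds for codes*, Math. Program. 109 (2007) 239–261, §2.1 p. 244
(`P = 2^[n]`, Hamming distance `|I ∆ J|`).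
-/

open Finset
open scoped symmDiff

namespace Literature.InformationTheory.Coding

variable {n : ℕ}


/-- Indicator of membership of a word in the code `C` (as an integer).
[cite: Gijswijt2010, Ch. 4 §2 (the vectors χ^{σC}; auxiliary)] -/
def codeInd (C : Finset (Finset (Fin n))) (S : Finset (Fin n)) : ℤ := if S ∈ C then 1 else 0

/-- [cite: Gijswijt2010, Ch. 4 §2 (auxiliary)] -/
theorem codeInd_nonneg (C : Finset (Finset (Fin n))) (S : Finset (Fin n)) : 0 ≤ codeInd C S := by
  unfold codeInd; split_ifs <;> simp

/-- [cite: Gijswijt2010, Ch. 4 §2 (auxiliary)] -/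
theorem codeInd_le_one (C : Finset (Finset (Fin n))) (S : Finset (Fin n)) : codeInd C S ≤ 1 := by
  unfold codeInd; split_ifs <;> simp

/-- [cite: Gijswijt2010, Ch. 4 §2 (auxiliary)] -/
theorem codeInd_mul_self (C : Finset (Finset (Fin n))) (S : Finset (Fin n)) :
    codeInd C S * codeInd C S = codeInd C S := by
  unfold codeInd; split_ifs <;> simp

/-- The word `I` moved by the cube automorphism encoded by `(z, π)`: `I ↦ π(I) ∆ z`.
[cite: Gijswijt2010, Ch. 4 §2 (the automorphisms σ ∈ Aut(q,n), q = 2: coordinate permutations and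
translations; auxiliary)] -/
def moveWord (z : Finset (Fin n)) (π : Equiv.Perm (Fin n)) (I : Finset (Fin n)) : Finset (Fin n) :=
  I.map π.toEmbedding ∆ z

/-- `σ_{z,π}` moves `∅` to `z`: `∅ ∈ σ(C)`-type conditions become `z ∈ C`. [cite: Gijswijt2010, Ch.
4 §2 (the automorphisms σ ∈ Aut(q,n), q = 2: coordinate permutations and translations; auxiliary)]
-/
theorem moveWord_empty (z : Finset (Fin n)) (π : Equiv.Perm (Fin n)) : moveWord z π ∅ = z := by
  simp [moveWord]

/-- Coordinate permutations are group automorphisms of `(2^[n], ∆)`. [cite: Gijswijt2010, Ch. 4 §2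
(the automorphisms σ ∈ Aut(q,n), q = 2: coordinate permutations and translations; auxiliary)] -/
theorem map_perm_symmDiff (π : Equiv.Perm (Fin n)) (I J : Finset (Fin n)) :
    (I ∆ J).map π.toEmbedding = I.map π.toEmbedding ∆ J.map π.toEmbedding := by
  simp only [map_eq_image]
  exact image_symmDiff _ _ π.injective

/-- [cite: Gijswijt2010, Ch. 4 §2 (the automorphisms σ ∈ Aut(q,n), q = 2: coordinate permutations
and translations; auxiliary)] -/
theorem moveWord_symmDiff (z : Finset (Fin n)) (π : Equiv.Perm (Fin n)) (I J : Finset (Fin n)) :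
    moveWord z π (I ∆ J) = moveWord z π I ∆ J.map π.toEmbedding := by
  rw [moveWord, moveWord, map_perm_symmDiff, symmDiff_right_comm]

/-- `σ_{z,π}` is an isometry: `σ(I) ∆ σ(J) = π(I ∆ J)`. [cite: Gijswijt2010, Ch. 4 §2 (the
automorphisms σ ∈ Aut(q,n), q = 2: coordinate permutations and translations; auxiliary)] -/
theorem moveWord_symmDiff_moveWord (z : Finset (Fin n)) (π : Equiv.Perm (Fin n))
    (I J : Finset (Fin n)) : moveWord z π I ∆ moveWord z π J = (I ∆ J).map π.toEmbedding := by
  rw [moveWord, moveWord, map_perm_symmDiff,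
    show J.map π.toEmbedding ∆ z = z ∆ J.map π.toEmbedding from symmDiff_comm _ _, ← symmDiff_assoc,
    symmDiff_symmDiff_cancel_right]

/-- `σ_{z,π}` preserves Hamming distances. [cite: Gijswijt2010, Ch. 4 §2 (the automorphisms σ ∈
Aut(q,n), q = 2: coordinate permutations and translations; auxiliary)] -/
theorem card_moveWord_symmDiff_moveWord (z : Finset (Fin n)) (π : Equiv.Perm (Fin n))
    (I J : Finset (Fin n)) : #(moveWord z π I ∆ moveWord z π J) = #(I ∆ J) := by
  rw [moveWord_symmDiff_moveWord, card_map]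

/-- The distance from `σ_{z,π}(I)` to `σ_{z,π}(∅) = z` is `|I|`. [cite: Gijswijt2010, Ch. 4 §2 (the
automorphisms σ ∈ Aut(q,n), q = 2: coordinate permutations and translations; auxiliary)] -/
theorem card_moveWord (z : Finset (Fin n)) (π : Equiv.Perm (Fin n)) (I : Finset (Fin n)) :
    #(moveWord z π I ∆ z) = #I := by
  rw [moveWord, symmDiff_symmDiff_cancel_right, card_map]

/-- Schrijver's matrix `M'_C` (integer normalisation): `M'_C(I,J) = Σ_{π ∈ Sym(n)} Σ_{z ⊆ [n]}
[z ∈ C] [π(I) ∆ z ∈ C] [π(J) ∆ z ∈ C]` = the number of automorphisms `σ` of the `n`-cube with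
`∅, I, J ∈ σ(C)`.
[cite: Schrijver2005, origin (the positive semidefinite matrices attached to a code); Gijswijt2010
Ch. 4 §2 (the matrix M', here in the integer normalisation |Aut| · M')] -/
def schrijverPos (C : Finset (Finset (Fin n))) (I J : Finset (Fin n)) : ℤ :=
  ∑ π : Equiv.Perm (Fin n), ∑ z : Finset (Fin n),
    codeInd C z * (codeInd C (moveWord z π I) * codeInd C (moveWord z π J))

/-- The full orbit sum `M_C(I,J) = Σ_{π} Σ_{z} [π(I) ∆ z ∈ C] [π(J) ∆ z ∈ C]` = the number of
automorphisms `σ` of the `n`-cube with `I, J ∈ σ(C)`.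
[cite: Gijswijt2010, Ch. 4 §2 (the matrix M = M' + M'' of the proof of Prop. 24, integer
normalisation)] -/
def schrijverAll (C : Finset (Finset (Fin n))) (I J : Finset (Fin n)) : ℤ :=
  ∑ π : Equiv.Perm (Fin n), ∑ z : Finset (Fin n),
    codeInd C (moveWord z π I) * codeInd C (moveWord z π J)

/-- Schrijver's second matrix `M''_C(I,J)` = the number of automorphisms `σ` of the `n`-cube with
`I, J ∈ σ(C)` but `∅ ∉ σ(C)`.
[cite: Schrijver2005, origin; Gijswijt2010 Ch. 4 §2 (the matrix M'', integer normalisation)] -/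
def schrijverNeg (C : Finset (Finset (Fin n))) (I J : Finset (Fin n)) : ℤ :=
  ∑ π : Equiv.Perm (Fin n), ∑ z : Finset (Fin n),
    (1 - codeInd C z) * (codeInd C (moveWord z π I) * codeInd C (moveWord z π J))

/-- `M = M' + M''`. [cite: Gijswijt2010, Ch. 4 §2 (proof of Prop. 24)] -/
theorem schrijverPos_add_schrijverNeg (C : Finset (Finset (Fin n))) (I J : Finset (Fin n)) :
    schrijverPos C I J + schrijverNeg C I J = schrijverAll C I J := by
  unfold schrijverPos schrijverNeg schrijverAll
  rw [← sum_add_distrib]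
  refine sum_congr rfl fun π _ => ?_
  rw [← sum_add_distrib]
  refine sum_congr rfl fun z _ => ?_
  ring

/-- `M'` is symmetric. [cite: Gijswijt2010, Ch. 4 §2 (auxiliary)] -/
theorem schrijverPos_comm (C : Finset (Finset (Fin n))) (I J : Finset (Fin n)) :
    schrijverPos C I J = schrijverPos C J I := by
  unfold schrijverPos
  exact sum_congr rfl fun π _ => sum_congr rfl fun z _ => by ring

/-- `M` is symmetric. [cite: Gijswijt2010, Ch. 4 §2 (auxiliary)] -/
theorem schrijverAll_comm (C : Finset (Finset (Fin n))) (I J : Finset (Fin n)) :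
    schrijverAll C I J = schrijverAll C J I := by
  unfold schrijverAll
  exact sum_congr rfl fun π _ => sum_congr rfl fun z _ => by ring

/-- `M''` is symmetric. [cite: Gijswijt2010, Ch. 4 §2 (auxiliary)] -/
theorem schrijverNeg_comm (C : Finset (Finset (Fin n))) (I J : Finset (Fin n)) :
    schrijverNeg C I J = schrijverNeg C J I := by
  unfold schrijverNeg
  exact sum_congr rfl fun π _ => sum_congr rfl fun z _ => by ring

/-! ### Positive semidefiniteness -/

/-- A kernel of the form `K(I,J) = Σ_a w_a f_a(I) f_a(J)` with `w_a ≥ 0` has nonnegative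
quadratic form.
[cite: Gijswijt2010, Ch. 4 §2 ("nonnegative combinations of the matrices χ^{σC}(χ^{σC})ᵀ are
positive semidefinite"; auxiliary)] -/
theorem sum_mul_sum_kernel_nonneg {α β : Type*} (s : Finset α) (t : Finset β) (w : α → ℤ)
    (hw : ∀ a ∈ s, 0 ≤ w a) (f : α → β → ℤ) (y : β → ℤ) :
    0 ≤ ∑ I ∈ t, ∑ J ∈ t, y I * (∑ a ∈ s, w a * (f a I * f a J)) * y J := by
  set g : α → β → β → ℤ := fun a I J => w a * ((y I * f a I) * (y J * f a J)) with hg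
  have h1 : ∑ I ∈ t, ∑ J ∈ t, y I * (∑ a ∈ s, w a * (f a I * f a J)) * y J =
      ∑ I ∈ t, ∑ J ∈ t, ∑ a ∈ s, g a I J := by
    refine sum_congr rfl fun I _ => sum_congr rfl fun J _ => ?_
    rw [mul_sum, sum_mul]
    exact sum_congr rfl fun a _ => by simp only [hg]; ring
  have h2 : ∑ a ∈ s, w a * (∑ I ∈ t, y I * f a I) ^ 2 = ∑ a ∈ s, ∑ I ∈ t, ∑ J ∈ t, g a I J := by
    refine sum_congr rfl fun a _ => ?_
    rw [sq, sum_mul_sum, mul_sum]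
    refine sum_congr rfl fun I _ => ?_
    rw [mul_sum]
  have h3 : ∑ I ∈ t, ∑ J ∈ t, ∑ a ∈ s, g a I J = ∑ a ∈ s, ∑ I ∈ t, ∑ J ∈ t, g a I J :=
    calc ∑ I ∈ t, ∑ J ∈ t, ∑ a ∈ s, g a I J = ∑ I ∈ t, ∑ a ∈ s, ∑ J ∈ t, g a I J :=
          sum_congr rfl fun I _ => sum_comm
      _ = ∑ a ∈ s, ∑ I ∈ t, ∑ J ∈ t, g a I J := sum_comm
  rw [h1, h3, ← h2]
  exact sum_nonneg fun a ha => mul_nonneg (hw a ha) (sq_nonneg _)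


/-! ### Reindexing tools: translations and coordinate permutations act on the words -/

/-- Translation `z ↦ z ∆ w` as a permutation of the words.
[cite: Gijswijt2010, Ch. 4 §2 (the automorphisms σ ∈ Aut(q,n), q = 2: coordinate permutations and
translations; auxiliary)] -/
def symmDiffEquiv (w : Finset (Fin n)) : Equiv.Perm (Finset (Fin n)) :=
  Function.Involutive.toPerm (fun z => z ∆ w) fun z => symmDiff_symmDiff_cancel_right w z

/-- [cite: Gijswijt2010, Ch. 4 §2 (the automorphisms σ ∈ Aut(q,n), q = 2: coordinate permutations
and translations; auxiliary)] -/
theorem symmDiffEquiv_apply (w z : Finset (Fin n)) : symmDiffEquiv w z = z ∆ w := rfl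

/-- Reindexing a sum over all words by a translation. [cite: Gijswijt2010, Ch. 4 §2 (the
automorphisms σ ∈ Aut(q,n), q = 2: coordinate permutations and translations; auxiliary)] -/
theorem sum_comp_symmDiff (w : Finset (Fin n)) (g : Finset (Fin n) → ℤ) :
    ∑ z, g (z ∆ w) = ∑ z, g z :=
  Equiv.sum_comp (symmDiffEquiv w) g

/-- Reindexing a sum over all words by a cube automorphism `σ_{z,π}`. [cite: Gijswijt2010, Ch. 4 §2
(the automorphisms σ ∈ Aut(q,n), q = 2: coordinate permutations and translations; auxiliary)] -/
theorem sum_comp_moveWord (z : Finset (Fin n)) (π : Equiv.Perm (Fin n)) (g : Finset (Fin n) → ℤ) :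
    ∑ I, g (moveWord z π I) = ∑ I, g I := by
  rw [← (π.finsetCongr.trans (symmDiffEquiv z)).sum_comp g]
  rfl

/-- Reindexing a sum over `Sym(n)` by right multiplication. [cite: Gijswijt2010, Ch. 4 §2 (the
automorphisms σ ∈ Aut(q,n), q = 2: coordinate permutations and translations; auxiliary)] -/
theorem sum_comp_perm_mul (ρ : Equiv.Perm (Fin n)) (g : Equiv.Perm (Fin n) → ℤ) :
    ∑ π, g (π * ρ) = ∑ π, g π :=
  Equiv.sum_comp (Equiv.mulRight ρ) g

/-- [cite: Gijswijt2010, Ch. 4 §2 (the automorphisms σ ∈ Aut(q,n), q = 2: coordinate permutations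
and translations; auxiliary)] -/
theorem map_map_perm (ρ π : Equiv.Perm (Fin n)) (I : Finset (Fin n)) :
    (I.map ρ.toEmbedding).map π.toEmbedding = I.map (π * ρ).toEmbedding := by
  rw [map_map]
  rfl

/-- Sums weighted by the indicator of `C` are sums over `C`. [cite: Gijswijt2010, Ch. 4 §2
(auxiliary)] -/
theorem sum_codeInd_mul (C : Finset (Finset (Fin n))) (F : Finset (Fin n) → ℤ) :
    ∑ S, codeInd C S * F S = ∑ S ∈ C, F S := by
  unfold codeInd
  simp only [ite_mul, one_mul, zero_mul, sum_ite_mem, univ_inter]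

/-- [cite: Gijswijt2010, Ch. 4 §2 (auxiliary)] -/
theorem sum_codeInd (C : Finset (Finset (Fin n))) : ∑ S, codeInd C S = #C := by
  have := sum_codeInd_mul C fun _ => 1
  simpa only [mul_one, sum_const, nsmul_eq_mul] using this

/-- [cite: Gijswijt2010, Ch. 4 §2 (the automorphisms σ ∈ Aut(q,n), q = 2: coordinate permutations
and translations; auxiliary)] -/
theorem moveWord_symmDiff_self (z : Finset (Fin n)) (π : Equiv.Perm (Fin n)) (I : Finset (Fin n)) :
    moveWord (z ∆ I.map π.toEmbedding) π I = z := by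
  rw [moveWord, symmDiff_comm z, symmDiff_symmDiff_cancel_left]

/-- [cite: Gijswijt2010, Ch. 4 §2 (the automorphisms σ ∈ Aut(q,n), q = 2: coordinate permutations
and translations; auxiliary)] -/
theorem moveWord_symmDiff_left (z : Finset (Fin n)) (π : Equiv.Perm (Fin n))
    (I J : Finset (Fin n)) :
    moveWord (z ∆ I.map π.toEmbedding) π J = moveWord z π (I ∆ J) := by
  ext x
  simp only [moveWord, map_perm_symmDiff, mem_symmDiff]
  tauto

/-- [cite: Gijswijt2010, Ch. 4 §2 (the automorphisms σ ∈ Aut(q,n), q = 2: coordinate permutations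
and translations; auxiliary)] -/
theorem moveWord_comm (z : Finset (Fin n)) (π : Equiv.Perm (Fin n)) (I : Finset (Fin n)) :
    z ∆ I.map π.toEmbedding = moveWord z π I := symmDiff_comm _ _

/-! ### Prop. 24 (binary): the full orbit sum is a translate of `M'`, and `M'' = M - M'` -/

/-- **Translation invariance**: `M_C(I,J) = M'_C(∅, I ∆ J)` — the number of cube automorphisms
with `I, J ∈ σ(C)` equals the number with `∅, I ∆ J ∈ σ(C)` (translate by `I`). In particular
`M_C` lies in the Bose–Mesner algebra (it depends on `|I ∆ J|` only).
[cite: Gijswijt2010, Ch. 4 §2 Prop. 24 (proof: M ∈ Bose–Mesner algebra, y_k = x^{0,0}_{k,0});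
Schrijver2005] -/
theorem schrijverAll_eq_schrijverPos_empty (C : Finset (Finset (Fin n))) (I J : Finset (Fin n)) :
    schrijverAll C I J = schrijverPos C ∅ (I ∆ J) := by
  unfold schrijverAll schrijverPos
  refine sum_congr rfl fun π _ => ?_
  rw [← sum_comp_symmDiff (I.map π.toEmbedding)
    (fun z => codeInd C (moveWord z π I) * codeInd C (moveWord z π J))]
  refine sum_congr rfl fun z _ => ?_
  simp only [moveWord_symmDiff_self, moveWord_symmDiff_left, moveWord_empty, ← mul_assoc,
    codeInd_mul_self]

/-- **Gijswijt Prop. 24 / Schrijver (binary)**: `M''_C(I,J) = M'_C(∅, I ∆ J) - M'_C(I,J)`, i.e.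
`M'' = Σ_{(i,j,t)} (x_{i+j-2t,0}^0 - x_{i,j}^t) M^t_{i,j}` in the basis of the Terwilliger algebra.
[cite: Gijswijt2010, Ch. 4 §2 Prop. 24 (q = 2); Schrijver2005] -/
theorem schrijverNeg_eq (C : Finset (Finset (Fin n))) (I J : Finset (Fin n)) :
    schrijverNeg C I J = schrijverPos C ∅ (I ∆ J) - schrijverPos C I J := by
  rw [← schrijverAll_eq_schrijverPos_empty, ← schrijverPos_add_schrijverNeg]
  ring

/-! ### Prop. 26 (binary): linear constraints on the entries of `M'` -/

/-- **Re-rooting symmetry (Prop. 26 (ii))**: `M'_C(I,J) = M'_C(I, I ∆ J)` — translating by `I`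
exchanges the roles of `∅` and `I` in `{∅, I, J} ⊆ σ(C)`; together with the symmetry in `(I,J)`
this is the invariance of `x^t_{i,j}` under permutations of the triangle `(i, j, i + j - 2t)`.
[cite: Gijswijt2010, Ch. 4 §2 Prop. 26 (ii); Schrijver2005] -/
theorem schrijverPos_reroot (C : Finset (Finset (Fin n))) (I J : Finset (Fin n)) :
    schrijverPos C I J = schrijverPos C I (I ∆ J) := by
  unfold schrijverPos
  refine sum_congr rfl fun π _ => ?_
  rw [← sum_comp_symmDiff (I.map π.toEmbedding)
    (fun z => codeInd C z * (codeInd C (moveWord z π I) * codeInd C (moveWord z π J)))]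
  refine sum_congr rfl fun z _ => ?_
  simp only [moveWord_symmDiff_self, moveWord_symmDiff_left]
  rw [moveWord_comm]
  ring

/-- `0 ≤ M'_C(I,J)` (Prop. 26 (i), lower bound). [cite: Gijswijt2010, Ch. 4 §2 Prop. 26 (i)] -/
theorem schrijverPos_nonneg (C : Finset (Finset (Fin n))) (I J : Finset (Fin n)) :
    0 ≤ schrijverPos C I J :=
  sum_nonneg fun _ _ => sum_nonneg fun _ _ =>
    mul_nonneg (codeInd_nonneg _ _) (mul_nonneg (codeInd_nonneg _ _) (codeInd_nonneg _ _))

/-- `0 ≤ M''_C(I,J)`. [cite: Gijswijt2010, Ch. 4 §2 (M'' is a nonnegative integer matrix)] -/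
theorem schrijverNeg_nonneg (C : Finset (Finset (Fin n))) (I J : Finset (Fin n)) :
    0 ≤ schrijverNeg C I J :=
  sum_nonneg fun _ _ => sum_nonneg fun z _ =>
    mul_nonneg (sub_nonneg.2 (codeInd_le_one C z))
      (mul_nonneg (codeInd_nonneg _ _) (codeInd_nonneg _ _))

/-- **Prop. 26 (i)**: `M'_C(I,J) ≤ M'_C(I,I)` (`0 ≤ x^t_{i,j} ≤ x^0_{i,0}`).
[cite: Gijswijt2010, Ch. 4 §2 Prop. 26 (i); Schrijver2005] -/
theorem schrijverPos_le_diag (C : Finset (Finset (Fin n))) (I J : Finset (Fin n)) :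
    schrijverPos C I J ≤ schrijverPos C I I := by
  unfold schrijverPos
  refine sum_le_sum fun π _ => sum_le_sum fun z _ => ?_
  rw [codeInd_mul_self]
  refine mul_le_mul_of_nonneg_left ?_ (codeInd_nonneg _ _)
  exact mul_le_of_le_one_right (codeInd_nonneg _ _) (codeInd_le_one _ _)

/-- The diagonal of `M'` is its `∅`-column: `M'_C(I,I) = M'_C(I,∅)` (`= x^0_{i,0}`).
[cite: Gijswijt2010, Ch. 4 §2 Prop. 26 (i) (the bound x^{0,0}_{i,0} is the diagonal entry)] -/
theorem schrijverPos_self (C : Finset (Finset (Fin n))) (I : Finset (Fin n)) :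
    schrijverPos C I I = schrijverPos C I ∅ := by
  unfold schrijverPos
  refine sum_congr rfl fun π _ => sum_congr rfl fun z _ => ?_
  rw [codeInd_mul_self, moveWord_empty, mul_comm (codeInd C (moveWord z π I)) (codeInd C z),
    ← mul_assoc, codeInd_mul_self]

/-- A summand-wise vanishing criterion for `M'_C(I,J)`.
[cite: Gijswijt2010, Ch. 4 §2 Prop. 26 (iii) (mechanism)] -/
theorem schrijverPos_eq_zero_of (C : Finset (Finset (Fin n))) (I J : Finset (Fin n))
    (h : ∀ (z : Finset (Fin n)) (π : Equiv.Perm (Fin n)),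
      z ∈ C → moveWord z π I ∈ C → moveWord z π J ∈ C → False) :
    schrijverPos C I J = 0 := by
  unfold schrijverPos
  refine sum_eq_zero fun π _ => sum_eq_zero fun z _ => ?_
  unfold codeInd
  split_ifs with h1 h2 h3 <;> first | rfl | simp
  · exact (h z π h1 h2 h3).elim

/-- **Prop. 26 (iii)**, distance between `I` and `J`: if all distances of `C` are `≥ d` and
`0 < |I ∆ J| < d` then `M'_C(I,J) = 0` (`x^t_{i,j} = 0` when `i + j - 2t ∈ {1,…,d-1}`).
[cite: Gijswijt2010, Ch. 4 §2 Prop. 26 (iii); Schrijver2005] -/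
theorem schrijverPos_eq_zero_of_symmDiff (C : Finset (Finset (Fin n))) {d : ℕ}
    (hC : ∀ u ∈ C, ∀ v ∈ C, u ≠ v → d ≤ #(u ∆ v)) {I J : Finset (Fin n)} (hIJ : I ≠ J)
    (hd : #(I ∆ J) < d) : schrijverPos C I J = 0 := by
  refine schrijverPos_eq_zero_of C I J fun z π _ ha hb => ?_
  have hne : moveWord z π I ≠ moveWord z π J := by
    intro he
    have : #(moveWord z π I ∆ moveWord z π J) = 0 := by
      rw [he, symmDiff_self, bot_eq_empty, card_empty]
    rw [card_moveWord_symmDiff_moveWord] at this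
    exact hIJ (symmDiff_eq_bot.1 (card_eq_zero.1 this))
  have := hC _ ha _ hb hne
  rw [card_moveWord_symmDiff_moveWord] at this
  omega

/-- **Prop. 26 (iii)**, distance between `∅` and `I`: if all distances of `C` are `≥ d` and
`0 < |I| < d` then `M'_C(I,J) = 0` (`x^t_{i,j} = 0` when `i ∈ {1,…,d-1}`).
[cite: Gijswijt2010, Ch. 4 §2 Prop. 26 (iii); Schrijver2005] -/
theorem schrijverPos_eq_zero_of_card (C : Finset (Finset (Fin n))) {d : ℕ}
    (hC : ∀ u ∈ C, ∀ v ∈ C, u ≠ v → d ≤ #(u ∆ v)) {I : Finset (Fin n)} (hI : I ≠ ∅)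
    (hd : #I < d) (J : Finset (Fin n)) : schrijverPos C I J = 0 := by
  refine schrijverPos_eq_zero_of C I J fun z π hz ha _ => ?_
  have hne : moveWord z π I ≠ z := by
    intro he
    have : #(moveWord z π I ∆ z) = 0 := by rw [he, symmDiff_self, bot_eq_empty, card_empty]
    rw [card_moveWord] at this
    exact hI (card_eq_zero.1 this)
  have := hC _ ha _ hz hne
  rw [card_moveWord] at this
  omega

/-! ### The objective: `Σ_J M'_C(∅,J) = n! |C|²` and `M'_C(∅,∅) = n! |C|` -/

/-- `M'_C(∅,∅) = n! · |C|` (the normalising entry `x^{0,0}_{0,0}`). [cite: Gijswijt2010, Ch. 4 §2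
Thm. 6 (proof: the normalisation x^{0,0}_{0,0}); Schrijver2005] -/
theorem schrijverPos_empty_empty (C : Finset (Finset (Fin n))) :
    schrijverPos C ∅ ∅ = (n.factorial : ℤ) * #C := by
  unfold schrijverPos
  simp only [moveWord_empty, codeInd_mul_self, sum_codeInd, sum_const, card_univ, Fintype.card_perm,
    Fintype.card_fin, nsmul_eq_mul]

/-- `Σ_J M'_C(∅,J) = n! · |C|²`, so the objective `Σ_i C(n,i) x^{0,0}_{i,0} / x^{0,0}_{0,0}`
evaluates to `|C|`. [cite: Gijswijt2010, Ch. 4 §2 Thm. 6 (proof: "a feasible solution with objective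
value |C|"); Schrijver2005] -/
theorem sum_schrijverPos_empty (C : Finset (Finset (Fin n))) :
    ∑ J, schrijverPos C ∅ J = (n.factorial : ℤ) * #C * #C := by
  unfold schrijverPos
  rw [sum_comm]
  have : ∀ π : Equiv.Perm (Fin n), ∑ J : Finset (Fin n), ∑ z : Finset (Fin n),
      codeInd C z * (codeInd C (moveWord z π ∅) * codeInd C (moveWord z π J)) = #C * #C := by
    intro π
    rw [sum_comm]
    simp only [moveWord_empty, ← mul_assoc, codeInd_mul_self, ← mul_sum]
    have hJ : ∀ z : Finset (Fin n), ∑ J, codeInd C (moveWord z π J) = #C := fun z => by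
      rw [sum_comp_moveWord z π (codeInd C), sum_codeInd]
    simp only [hJ, ← sum_mul, sum_codeInd]
  simp only [this, sum_const, card_univ, Fintype.card_perm, Fintype.card_fin, nsmul_eq_mul,
    mul_assoc]

/-! ### Invariance under `Sym(n)`: `M'_C` lies in the Terwilliger algebra -/

/-- `M'_C(π I, π J) = M'_C(I, J)` for every coordinate permutation `π`.
[cite: Gijswijt2010, Ch. 4 §2 ("M' and M'' are invariant under permutations σ ∈ Stab … hence
elements of the algebra 𝒜_{q,n}"); Schrijver2005] -/
theorem schrijverPos_map_perm (C : Finset (Finset (Fin n))) (ρ : Equiv.Perm (Fin n))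
    (I J : Finset (Fin n)) :
    schrijverPos C (I.map ρ.toEmbedding) (J.map ρ.toEmbedding) = schrijverPos C I J := by
  unfold schrijverPos
  simp only [moveWord, map_map_perm]
  exact sum_comp_perm_mul ρ fun π => ∑ z : Finset (Fin n),
    codeInd C z * (codeInd C (I.map π.toEmbedding ∆ z) * codeInd C (J.map π.toEmbedding ∆ z))

/-- **`M'_C ∈ 𝓐_n`**: the entry `M'_C(I,J)` depends only on the orbit invariant
`(|I|, |J|, |I ∩ J|)`, i.e. `M'_C = Σ_{(i,j,t)} x^t_{i,j} M^t_{i,j}`.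
[cite: Gijswijt2010, Ch. 4 §2 (M' ∈ 𝒜_{q,n}, eq. M' = Σ x^{t,p}_{i,j} M^{t,p}_{i,j}); Schrijver2005]
-/
theorem schrijverPos_eq_of_orbitTriple_eq (C : Finset (Finset (Fin n))) {I J I' J' : Finset (Fin n)}
    (h : orbitTriple I J = orbitTriple I' J') : schrijverPos C I J = schrijverPos C I' J' := by
  obtain ⟨ρ, hI, hJ⟩ := exists_perm_map_eq_of_orbitTriple_eq h
  rw [← hI, ← hJ, schrijverPos_map_perm]

/-! ### Prop. 25 (binary): the entries of `M'` count triples of code words -/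

/-- `λ_p(C)`: the number of triples `(u, v, w) ∈ C³` in the class `p = (d(u,v), d(u,w), ·)`,
precisely with `(|u ∆ v|, |u ∆ w|, |(u ∆ v) ∩ (u ∆ w)|) = p`.
[cite: Gijswijt2010, Ch. 4 §2 (the numbers λ^{t,p}_{i,j} := |(C×C×C) ∩ X_{i,j,t,p}|, q = 2)] -/
def tripleCount (C : Finset (Finset (Fin n))) (p : ℕ × ℕ × ℕ) : ℤ :=
  ∑ u ∈ C, ∑ v ∈ C, ∑ w ∈ C, if orbitTriple (v ∆ u) (w ∆ u) = p then 1 else 0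

/-- **Gijswijt Prop. 25 / Schrijver (binary), integer form**: summing `M'_C` over the orbit
`p` of pairs gives `n! · λ_p(C)`; since `M'_C` is constant on the orbit (value `x_p`) this is
`γ_p x_p = n! λ_p`, i.e. `x_p = n! λ_p / γ_p` with `γ_p` the orbit size.
[cite: Gijswijt2010, Ch. 4 §2 Prop. 25 (q = 2, integer form); Schrijver2005] -/
theorem sum_schrijverPos_orbit (C : Finset (Finset (Fin n))) (p : ℕ × ℕ × ℕ) :
    ∑ I, ∑ J, (if orbitTriple I J = p then schrijverPos C I J else 0) =
      (n.factorial : ℤ) * tripleCount C p := by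
  -- push the orbit indicator inside and bring the sums over `π, z` outside
  have h1 : ∀ I J : Finset (Fin n), (if orbitTriple I J = p then schrijverPos C I J else 0) =
      ∑ π : Equiv.Perm (Fin n), ∑ z : Finset (Fin n), codeInd C z *
        ((if orbitTriple I J = p then 1 else 0) *
          (codeInd C (moveWord z π I) * codeInd C (moveWord z π J))) := by
    intro I J
    split_ifs
    · simp only [one_mul]; rfl
    · simp
  simp_rw [h1]
  -- reorder the four sums to `Σ_π Σ_z Σ_I Σ_J`
  have h2 : ∀ F : Finset (Fin n) → Finset (Fin n) → Equiv.Perm (Fin n) → Finset (Fin n) → ℤ,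
      ∑ I : Finset (Fin n), ∑ J : Finset (Fin n), ∑ π : Equiv.Perm (Fin n), ∑ z : Finset (Fin n),
        F I J π z = ∑ π, ∑ z, ∑ I, ∑ J, F I J π z := by
    intro F
    calc ∑ I, ∑ J, ∑ π, ∑ z, F I J π z = ∑ I, ∑ π, ∑ J, ∑ z, F I J π z :=
          sum_congr rfl fun I _ => sum_comm
      _ = ∑ π, ∑ I, ∑ J, ∑ z, F I J π z := sum_comm
      _ = ∑ π, ∑ I, ∑ z, ∑ J, F I J π z :=
          sum_congr rfl fun π _ => sum_congr rfl fun I _ => sum_comm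
      _ = ∑ π, ∑ z, ∑ I, ∑ J, F I J π z := sum_congr rfl fun π _ => sum_comm
  rw [h2]
  -- for fixed `(π, z)` substitute `v = π(I) ∆ z`, `w = π(J) ∆ z`
  have h3 : ∀ (π : Equiv.Perm (Fin n)) (z : Finset (Fin n)),
      ∑ I : Finset (Fin n), ∑ J : Finset (Fin n), codeInd C z *
        ((if orbitTriple I J = p then 1 else 0) *
          (codeInd C (moveWord z π I) * codeInd C (moveWord z π J))) =
      codeInd C z * ∑ v ∈ C, ∑ w ∈ C, if orbitTriple (v ∆ z) (w ∆ z) = p then 1 else 0 := by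
    intro π z
    set g : Finset (Fin n) → Finset (Fin n) → ℤ := fun v w =>
      codeInd C v * (codeInd C w * if orbitTriple (v ∆ z) (w ∆ z) = p then 1 else 0) with hg
    have hgm : ∀ I J : Finset (Fin n), codeInd C z * ((if orbitTriple I J = p then 1 else 0) *
        (codeInd C (moveWord z π I) * codeInd C (moveWord z π J))) =
        codeInd C z * g (moveWord z π I) (moveWord z π J) := by
      intro I J
      simp only [hg, moveWord, symmDiff_symmDiff_cancel_right, orbitTriple_map_perm]
      ring
    simp_rw [hgm, ← mul_sum]
    congr 1
    rw [show (∑ I, ∑ J, g (moveWord z π I) (moveWord z π J)) = ∑ I, ∑ J, g I J from by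
      rw [← sum_comp_moveWord z π fun I => ∑ J, g I J]
      exact sum_congr rfl fun I _ => (sum_comp_moveWord z π fun J => g (moveWord z π I) J)]
    simp only [hg, sum_codeInd_mul, ← mul_sum]
  simp_rw [h3]
  simp only [sum_codeInd_mul, sum_const, card_univ, Fintype.card_perm, Fintype.card_fin,
    nsmul_eq_mul, tripleCount]


/-! ### Matrix form: `M'_C`, `M''_C` are positive semidefinite elements of `𝓐_n` -/

/-- Schrijver's matrix `M'_C ∈ ℤ^{P × P}` (`P` = subsets of `[n]`).
[cite: Schrijver2005, origin; Gijswijt2010 Ch. 4 §2 (M')] -/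
def schrijverPosMatrix (C : Finset (Finset (Fin n))) : Matrix (Finset (Fin n)) (Finset (Fin n)) ℤ :=
  Matrix.of fun I J => schrijverPos C I J

/-- Schrijver's matrix `M''_C ∈ ℤ^{P × P}`.
[cite: Schrijver2005, origin; Gijswijt2010 Ch. 4 §2 (M'')] -/
def schrijverNegMatrix (C : Finset (Finset (Fin n))) : Matrix (Finset (Fin n)) (Finset (Fin n)) ℤ :=
  Matrix.of fun I J => schrijverNeg C I J

/-- `M'_C` as a single sum over `Aut = Sym(n) × 2^[n]` of rank-one terms. [cite: Gijswijt2010, Ch. 4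
§2 (M' = |Aut|⁻¹ Σ_{σ : 0 ∈ σC} χ^{σC}(χ^{σC})ᵀ)] -/
theorem schrijverPos_eq_kernel (C : Finset (Finset (Fin n))) (I J : Finset (Fin n)) :
    schrijverPos C I J = ∑ a : Equiv.Perm (Fin n) × Finset (Fin n),
      codeInd C a.2 * (codeInd C (moveWord a.2 a.1 I) * codeInd C (moveWord a.2 a.1 J)) := by
  rw [schrijverPos, Fintype.sum_prod_type]

/-- `M''_C` as a single sum over `Aut` of rank-one terms. [cite: Gijswijt2010, Ch. 4 §2 (M'' =
|Aut|⁻¹ Σ_{σ : 0 ∉ σC} χ^{σC}(χ^{σC})ᵀ)] -/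
theorem schrijverNeg_eq_kernel (C : Finset (Finset (Fin n))) (I J : Finset (Fin n)) :
    schrijverNeg C I J = ∑ a : Equiv.Perm (Fin n) × Finset (Fin n),
      (1 - codeInd C a.2) * (codeInd C (moveWord a.2 a.1 I) * codeInd C (moveWord a.2 a.1 J)) := by
  rw [schrijverNeg, Fintype.sum_prod_type]

/-- The quadratic form of `M'_C` is nonnegative: `yᵀ M'_C y = Σ_{σ : ∅ ∈ σC} (Σ_{I ∈ σC} y_I)² ≥ 0`.
[cite: Gijswijt2010, Ch. 4 §2 ("M' and M'' are positive semidefinite"); Schrijver2005] -/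
theorem quadForm_schrijverPos_nonneg (C : Finset (Finset (Fin n))) (y : Finset (Fin n) → ℤ) :
    0 ≤ ∑ I, ∑ J, y I * schrijverPos C I J * y J := by
  simp_rw [schrijverPos_eq_kernel]
  exact sum_mul_sum_kernel_nonneg univ univ _ (fun a _ => codeInd_nonneg C a.2) _ y

/-- The quadratic form of `M''_C` is nonnegative.
[cite: Gijswijt2010, Ch. 4 §2 ("M' and M'' are positive semidefinite"); Schrijver2005] -/
theorem quadForm_schrijverNeg_nonneg (C : Finset (Finset (Fin n))) (y : Finset (Fin n) → ℤ) :
    0 ≤ ∑ I, ∑ J, y I * schrijverNeg C I J * y J := by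
  simp_rw [schrijverNeg_eq_kernel]
  exact sum_mul_sum_kernel_nonneg univ univ _ (fun a _ => sub_nonneg.2 (codeInd_le_one C a.2)) _ y

/-- **`M'_C ⪰ 0`** (Schrijver 2005; Gijswijt 2005 Ch. 4 §2: `M'` is a nonnegative combination of
the rank-one matrices `χ^{σC} (χ^{σC})ᵀ`).
[cite: Gijswijt2010, Ch. 4 §2 ("An important feature of the matrices M' and M'' is, that they are
positive semidefinite"); Schrijver2005] -/
theorem posSemidef_schrijverPosMatrix (C : Finset (Finset (Fin n))) :
    (schrijverPosMatrix C).PosSemidef := by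
  refine Matrix.PosSemidef.of_dotProduct_mulVec_nonneg ?_ fun x => ?_
  · refine Matrix.IsHermitian.ext fun I J => ?_
    rw [star_trivial, schrijverPosMatrix, Matrix.of_apply, Matrix.of_apply]
    exact schrijverPos_comm C J I
  · have : dotProduct (star x) ((schrijverPosMatrix C).mulVec x) =
        ∑ I, ∑ J, x I * schrijverPos C I J * x J := by
      simp only [star_trivial, dotProduct, Matrix.mulVec, schrijverPosMatrix, Matrix.of_apply,
        mul_sum, mul_assoc]
    rw [this]
    exact quadForm_schrijverPos_nonneg C x

/-- **`M''_C ⪰ 0`** (Schrijver 2005; Gijswijt 2005 Ch. 4 §2).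
[cite: Gijswijt2010, Ch. 4 §2 (positive semidefiniteness of M''); Schrijver2005] -/
theorem posSemidef_schrijverNegMatrix (C : Finset (Finset (Fin n))) :
    (schrijverNegMatrix C).PosSemidef := by
  refine Matrix.PosSemidef.of_dotProduct_mulVec_nonneg ?_ fun x => ?_
  · refine Matrix.IsHermitian.ext fun I J => ?_
    rw [star_trivial, schrijverNegMatrix, Matrix.of_apply, Matrix.of_apply]
    exact schrijverNeg_comm C J I
  · have : dotProduct (star x) ((schrijverNegMatrix C).mulVec x) =
        ∑ I, ∑ J, x I * schrijverNeg C I J * x J := by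
      simp only [star_trivial, dotProduct, Matrix.mulVec, schrijverNegMatrix, Matrix.of_apply,
        mul_sum, mul_assoc]
    rw [this]
    exact quadForm_schrijverNeg_nonneg C x

/-- `x_p(C)`: the common value of `M'_C` on the orbit `p ∈ 𝓘(2,n)` of pairs (`0` if `p` is not
realised) — Schrijver's variables `x^t_{i,j}` in integer normalisation.
[cite: Schrijver2005, the variables x^t_{i,j}; Gijswijt2010 Ch. 4 §2 (eq. M' = Σ x^{t,p}_{i,j}
M^{t,p}_{i,j})] -/
noncomputable def xcoeff (C : Finset (Finset (Fin n))) (p : ℕ × ℕ × ℕ) : ℤ :=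
  if h : ∃ IJ : Finset (Fin n) × Finset (Fin n), orbitTriple IJ.1 IJ.2 = p then
    schrijverPos C h.choose.1 h.choose.2 else 0

/-- `x_p(C)` is the value of `M'_C` at ANY pair of the orbit `p`. [cite: Gijswijt2010, Ch. 4 §2
(coefficients of M' in the basis M^{t,p}_{i,j})] -/
theorem xcoeff_orbitTriple (C : Finset (Finset (Fin n))) (I J : Finset (Fin n)) :
    xcoeff C (orbitTriple I J) = schrijverPos C I J := by
  unfold xcoeff
  have h : ∃ IJ : Finset (Fin n) × Finset (Fin n), orbitTriple IJ.1 IJ.2 = orbitTriple I J :=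
    ⟨(I, J), rfl⟩
  rw [dif_pos h]
  exact schrijverPos_eq_of_orbitTriple_eq C h.choose_spec

/-- `x_p(C) = 0` outside `𝓘(2,n)`. [cite: Gijswijt2010, Ch. 4 §2 (auxiliary)] -/
theorem xcoeff_of_not_mem (C : Finset (Finset (Fin n))) {p : ℕ × ℕ × ℕ}
    (hp : p ∉ terwilligerIndex n) : xcoeff C p = 0 := by
  unfold xcoeff
  rw [dif_neg]
  rintro ⟨IJ, hIJ⟩
  exact hp (hIJ ▸ orbitTriple_mem_terwilligerIndex IJ.1 IJ.2)

/-- `x_p(C) ≥ 0`. [cite: Gijswijt2010, Ch. 4 §2 Prop. 26 (i)] -/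
theorem xcoeff_nonneg (C : Finset (Finset (Fin n))) (p : ℕ × ℕ × ℕ) : 0 ≤ xcoeff C p := by
  unfold xcoeff
  split_ifs
  · exact schrijverPos_nonneg _ _ _
  · exact le_rfl

/-- **`M'_C = Σ_{p ∈ 𝓘(2,n)} x_p M_p`**: Schrijver's matrix lies in the Terwilliger algebra.
[cite: Gijswijt2010, Ch. 4 §2 (eq. M' = Σ_{(i,j,t,p)} x^{t,p}_{i,j} M^{t,p}_{i,j}); Schrijver2005]
-/
theorem schrijverPosMatrix_eq_sum (C : Finset (Finset (Fin n))) :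
    schrijverPosMatrix C = ∑ p ∈ terwilligerIndex n, xcoeff C p • orbitMatrix n p := by
  ext I J
  rw [Matrix.sum_apply]
  simp only [Matrix.smul_apply, orbitMatrix_apply, smul_eq_mul, mul_ite, mul_one, mul_zero,
    sum_ite_eq, if_pos (orbitTriple_mem_terwilligerIndex I J), xcoeff_orbitTriple]
  rfl

/-- The orbit of `(∅, K)` is `(0, |K|, 0)` — the variables `x^{0}_{k,0}` (up to the symmetry `(i,j)
↔ (j,i)`). [cite: Gijswijt2010, Ch. 4 §2 (auxiliary)] -/
theorem orbitTriple_empty_left (K : Finset (Fin n)) : orbitTriple ∅ K = (0, #K, 0) := by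
  simp [orbitTriple]

/-- Hamming distance `|I ∆ J| = i + j - 2t`. [cite: Gijswijt2010, Ch. 4 §2 (d(v,w) = i + j - t - p
with p = t for q = 2; auxiliary)] -/
theorem card_symmDiff_eq (I J : Finset (Fin n)) : #(I ∆ J) = #I + #J - 2 * #(I ∩ J) := by
  have := card_symmDiff_add I J
  omega

/-- **`M''_C = Σ_{(i,j,t) ∈ 𝓘(2,n)} (x^0_{i+j-2t,0} - x^t_{i,j}) M^t_{i,j}`** (Gijswijt Prop. 24,
binary; here `x^0_{k,0} = x_{(0,k,0)} = M'_C(∅, K)` for `|K| = k`).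
[cite: Gijswijt2010, Ch. 4 §2 Prop. 24 (q = 2); Schrijver2005] -/
theorem schrijverNegMatrix_eq_sum (C : Finset (Finset (Fin n))) :
    schrijverNegMatrix C = ∑ p ∈ terwilligerIndex n,
      (xcoeff C (0, p.1 + p.2.1 - 2 * p.2.2, 0) - xcoeff C p) • orbitMatrix n p := by
  ext I J
  rw [Matrix.sum_apply]
  simp only [Matrix.smul_apply, orbitMatrix_apply, smul_eq_mul, mul_ite, mul_one, mul_zero,
    sum_ite_eq, if_pos (orbitTriple_mem_terwilligerIndex I J), xcoeff_orbitTriple]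
  rw [schrijverNegMatrix, Matrix.of_apply, schrijverNeg_eq, ← xcoeff_orbitTriple C ∅,
    orbitTriple_empty_left, card_symmDiff_eq]
  rfl

/-! ### The orbit relation `γ_p x_p = n! λ_p` (Prop. 25) -/

/-- `γ_p = |{(I,J) : (|I|,|J|,|I ∩ J|) = p}|`, the number of nonzero entries of `M_p`.
[cite: Gijswijt2010, Ch. 4 §2 (the numbers γ^{t,p}_{i,j} = number of nonzero entries of
M^{t,p}_{i,j})] -/
def orbitSize (n : ℕ) (p : ℕ × ℕ × ℕ) : ℕ :=
  #((univ : Finset (Finset (Fin n) × Finset (Fin n))).filter fun IJ => orbitTriple IJ.1 IJ.2 = p)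

/-- **Prop. 25 (binary), pointwise**: `γ_p · M'_C(I,J) = n! · λ_p(C)` for `p` the orbit of
`(I,J)`; i.e. `x^t_{i,j} = n! λ^t_{i,j} / γ^t_{i,j}` (Gijswijt: `x = q^{-n} γ^{-1} λ` in the
normalisation `|Aut|^{-1} Σ_σ`).
[cite: Gijswijt2010, Ch. 4 §2 Prop. 25 (q = 2); Schrijver2005] -/
theorem orbitSize_mul_schrijverPos (C : Finset (Finset (Fin n))) (I J : Finset (Fin n)) :
    (orbitSize n (orbitTriple I J) : ℤ) * schrijverPos C I J =
      (n.factorial : ℤ) * tripleCount C (orbitTriple I J) := by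
  rw [← sum_schrijverPos_orbit]
  have h : ∀ I' J' : Finset (Fin n),
      (if orbitTriple I' J' = orbitTriple I J then schrijverPos C I' J' else 0) =
        (if orbitTriple I' J' = orbitTriple I J then 1 else 0) * schrijverPos C I J := by
    intro I' J'
    split_ifs with h
    · rw [one_mul, schrijverPos_eq_of_orbitTriple_eq C h]
    · rw [zero_mul]
  simp_rw [h, ← sum_mul]
  congr 1
  rw [orbitSize, card_filter, Nat.cast_sum, Fintype.sum_prod_type]
  simp only [Nat.cast_ite, Nat.cast_one, Nat.cast_zero]

/-! ### Schrijver's semidefinite programming bound in certificate form -/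

/-- [cite: Gijswijt2010, Ch. 4 §2 (auxiliary)] -/
theorem inter_symmDiff_self (I J : Finset (Fin n)) : I ∩ (I ∆ J) = I \ J := by
  ext x
  simp only [mem_inter, mem_symmDiff, mem_sdiff]
  tauto

/-- Re-rooting a pair at `I`: the orbit of `(I, I ∆ J)` is `(i, i + j - 2t, i - t)`. [cite:
Gijswijt2010, Ch. 4 §2 Prop. 26 (ii) (the permutation (i, j, i+j-t-p) ↦ (i, i+j-t-p, j); auxiliary)]
-/
theorem orbitTriple_self_symmDiff (I J : Finset (Fin n)) :
    orbitTriple I (I ∆ J) = (#I, #I + #J - 2 * #(I ∩ J), #I - #(I ∩ J)) := by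
  rw [orbitTriple, card_symmDiff_eq, inter_symmDiff_self]
  have := card_sdiff_add_card_inter I J
  simp only [Prod.mk.injEq, true_and]
  omega

/-- **Schrijver's constraints.** The (homogeneous, integer) constraints satisfied by the orbit
values `x_p = x^t_{i,j}` of `M'_C` for every code `C ⊆ 2^[n]` with minimum distance `≥ d`
(Schrijver 2005; Gijswijt 2005 Ch. 4 §2, Prop. 24 and Prop. 26 (i)–(iii)): both block matrices are
positive semidefinite, `0 ≤ x^t_{i,j} ≤ x^0_{i,0}`, invariance under the permutations of the
triangle `(i, j, i + j - 2t)`, and vanishing on forbidden distances.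
[cite: Schrijver2005, the semidefinite program; Gijswijt2010 Ch. 4 §2 Thm. 6 with Prop. 24 and Prop.
26 (i)–(iii) (q = 2; homogeneous integer form, normalisation x^{0,0}_{0,0} = 1 replaced by
homogeneity)] -/
structure SchrijverFeasible (n d : ℕ) (x : ℕ × ℕ × ℕ → ℤ) : Prop where
  /-- [cite: Gijswijt2010, Ch. 4 §2 — M' ⪰ 0; Schrijver2005] -/
  posSemidef_pos : (∑ p ∈ terwilligerIndex n, x p • orbitMatrix n p).PosSemidef
  /-- [cite: Gijswijt2010, Ch. 4 §2 — M'' ⪰ 0 in the form of Prop. 24; Schrijver2005] -/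
  posSemidef_neg :
    (∑ p ∈ terwilligerIndex n,
      (x (0, p.1 + p.2.1 - 2 * p.2.2, 0) - x p) • orbitMatrix n p).PosSemidef
  /-- [cite: Gijswijt2010, Ch. 4 §2 — Prop. 26 (i), lower bound; Schrijver2005] -/
  nonneg : ∀ p, 0 ≤ x p
  /-- [cite: Gijswijt2010, Ch. 4 §2 — Prop. 26 (i), upper bound x ≤ x^{0,0}_{i,0}; Schrijver2005] -/
  le_diag : ∀ p ∈ terwilligerIndex n, x p ≤ x (p.1, 0, 0)
  /-- [cite: Gijswijt2010, Ch. 4 §2 — symmetry of M' ((i,j) ↔ (j,i)); Schrijver2005] -/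
  swap : ∀ p ∈ terwilligerIndex n, x p = x (p.2.1, p.1, p.2.2)
  /-- [cite: Gijswijt2010, Ch. 4 §2 — Prop. 26 (ii); Schrijver2005] -/
  reroot : ∀ p ∈ terwilligerIndex n, x p = x (p.1, p.1 + p.2.1 - 2 * p.2.2, p.1 - p.2.2)
  /-- [cite: Gijswijt2010, Ch. 4 §2 — Prop. 26 (iii), i ∈ {1,…,d-1}; Schrijver2005] -/
  dist_left : ∀ p ∈ terwilligerIndex n, 1 ≤ p.1 → p.1 < d → x p = 0
  /-- [cite: Gijswijt2010, Ch. 4 §2 — Prop. 26 (iii), i+j-2t ∈ {1,…,d-1}; Schrijver2005] -/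
  dist_pair : ∀ p ∈ terwilligerIndex n, 1 ≤ p.1 + p.2.1 - 2 * p.2.2 → p.1 + p.2.1 - 2 * p.2.2 < d →
    x p = 0

/-- **Every code is feasible**: for a code `C` with minimum distance `≥ d`, `x = x(C)` satisfies
Schrijver's constraints.
[cite: Gijswijt2010, Ch. 4 §2 Thm. 6 (proof: "gives a feasible solution"); Schrijver2005] -/
theorem schrijverFeasible_xcoeff (C : Finset (Finset (Fin n))) {d : ℕ}
    (hC : ∀ u ∈ C, ∀ v ∈ C, u ≠ v → d ≤ #(u ∆ v)) : SchrijverFeasible n d (xcoeff C) where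
  posSemidef_pos := by rw [← schrijverPosMatrix_eq_sum]; exact posSemidef_schrijverPosMatrix C
  posSemidef_neg := by rw [← schrijverNegMatrix_eq_sum]; exact posSemidef_schrijverNegMatrix C
  nonneg := xcoeff_nonneg C
  le_diag := by
    rintro ⟨i, j, t⟩ hp
    obtain ⟨I, J, hIJ⟩ := exists_pair_of_mem_terwilligerIndex hp
    have hi : #I = i := congrArg Prod.fst hIJ
    rw [← hIJ, xcoeff_orbitTriple, show ((orbitTriple I J).1, 0, 0) = orbitTriple I ∅ by
      simp [orbitTriple], xcoeff_orbitTriple, ← schrijverPos_self]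
    exact schrijverPos_le_diag C I J
  swap := by
    rintro ⟨i, j, t⟩ hp
    obtain ⟨I, J, hIJ⟩ := exists_pair_of_mem_terwilligerIndex hp
    rw [← hIJ, xcoeff_orbitTriple, show ((orbitTriple I J).2.1, (orbitTriple I J).1,
      (orbitTriple I J).2.2) = orbitTriple J I by simp [orbitTriple, inter_comm],
      xcoeff_orbitTriple]
    exact schrijverPos_comm C I J
  reroot := by
    rintro ⟨i, j, t⟩ hp
    obtain ⟨I, J, hIJ⟩ := exists_pair_of_mem_terwilligerIndex hp
    rw [← hIJ, xcoeff_orbitTriple, show ((orbitTriple I J).1, (orbitTriple I J).1 +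
      (orbitTriple I J).2.1 - 2 * (orbitTriple I J).2.2,
      (orbitTriple I J).1 - (orbitTriple I J).2.2) = orbitTriple I (I ∆ J) by
        rw [orbitTriple_self_symmDiff]; rfl, xcoeff_orbitTriple]
    exact schrijverPos_reroot C I J
  dist_left := by
    rintro ⟨i, j, t⟩ hp h1 hd
    obtain ⟨I, J, hIJ⟩ := exists_pair_of_mem_terwilligerIndex hp
    have hi : #I = i := congrArg Prod.fst hIJ
    rw [← hIJ, xcoeff_orbitTriple]
    refine schrijverPos_eq_zero_of_card C hC ?_ (by simp only at hd; omega) J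
    rintro rfl
    simp only [card_empty] at hi
    simp only at h1
    omega
  dist_pair := by
    rintro ⟨i, j, t⟩ hp h1 hd
    obtain ⟨I, J, hIJ⟩ := exists_pair_of_mem_terwilligerIndex hp
    have hi : #I = i := congrArg Prod.fst hIJ
    have hj : #J = j := congrArg (fun q => q.2.1) hIJ
    have ht : #(I ∩ J) = t := congrArg (fun q => q.2.2) hIJ
    have hs := card_symmDiff_add I J
    simp only at h1 hd
    have hcard : #(I ∆ J) = i + j - 2 * t := by omega
    rw [← hIJ, xcoeff_orbitTriple]
    refine schrijverPos_eq_zero_of_symmDiff C hC ?_ (by omega)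
    intro he
    rw [he, symmDiff_self, bot_eq_empty, card_empty] at hcard
    omega

/-- The objective at `x(C)`: `Σ_k C(n,k) x_{(0,k,0)}(C) = Σ_J M'_C(∅,J) = n! |C|²`.
[cite: Gijswijt2010, Ch. 4 §2 Thm. 6 (objective Σ_i C(n,i)(q-1)^i x^{0,0}_{i,0}, q = 2);
Schrijver2005] -/
theorem sum_choose_mul_xcoeff (C : Finset (Finset (Fin n))) :
    ∑ k ∈ range (n + 1), (n.choose k : ℤ) * xcoeff C (0, k, 0) = (n.factorial : ℤ) * #C * #C := by
  rw [← sum_schrijverPos_empty]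
  have h : ∀ J : Finset (Fin n), schrijverPos C ∅ J = xcoeff C (0, #J, 0) := fun J => by
    rw [← orbitTriple_empty_left, xcoeff_orbitTriple]
  simp_rw [h]
  rw [← sum_fiberwise_of_maps_to (s := (univ : Finset (Finset (Fin n)))) (t := range (n + 1))
    (g := fun J => #J) (fun J _ => mem_range.2 (Nat.lt_succ_of_le (by simpa using card_le_univ J)))]
  refine sum_congr rfl fun k _ => ?_
  rw [sum_congr rfl fun J (hJ : J ∈ univ.filter fun J => #J = k) => by rw [(mem_filter.1 hJ).2],
    sum_const, univ_filter_card_eq, card_powersetCard, card_univ, Fintype.card_fin, nsmul_eq_mul]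

/-- `x_{(0,0,0)}(C) = n! |C|`. [cite: Gijswijt2010, Ch. 4 §2 Thm. 6 (normalisation); Schrijver2005]
-/
theorem xcoeff_zero (C : Finset (Finset (Fin n))) :
    xcoeff C (0, 0, 0) = (n.factorial : ℤ) * #C := by
  rw [← schrijverPos_empty_empty, ← xcoeff_orbitTriple, orbitTriple_empty_left, card_empty]

/-- **Schrijver's semidefinite programming bound (certificate form)** (Schrijver 2005, the bound
on `A(n,d)`; Gijswijt 2005 Ch. 4 §2 Thm. 6 for `q = 2`): if `B` bounds the objective
`Σ_k C(n,k) x_{(0,k,0)}` by `B · x_{(0,0,0)}` for every `x` satisfying Schrijver's constraints, then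
every binary code of length `n` and minimum distance `≥ d` has at most `B` words. (A dual SDP
solution is exactly a certificate for the hypothesis.)
[cite: Schrijver2005, main theorem (the SDP value bounds A(n,d)); Gijswijt2010 Ch. 4 §2 Thm. 6 (q =
2)] -/
theorem card_le_of_schrijverBound {d B : ℕ}
    (hB : ∀ x : ℕ × ℕ × ℕ → ℤ, SchrijverFeasible n d x →
      ∑ k ∈ range (n + 1), (n.choose k : ℤ) * x (0, k, 0) ≤ B * x (0, 0, 0))
    (C : Finset (Finset (Fin n))) (hC : ∀ u ∈ C, ∀ v ∈ C, u ≠ v → d ≤ #(u ∆ v)) : #C ≤ B := by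
  rcases C.eq_empty_or_nonempty with rfl | hne
  · simp
  have h := hB (xcoeff C) (schrijverFeasible_xcoeff C hC)
  rw [sum_choose_mul_xcoeff, xcoeff_zero] at h
  have hpos : (0 : ℤ) < (n.factorial : ℤ) * #C := by
    have := hne.card_pos
    positivity
  have h' : ((#C : ℕ) : ℤ) * ((n.factorial : ℤ) * #C) ≤ (B : ℤ) * ((n.factorial : ℤ) * #C) := by
    linarith
  exact_mod_cast le_of_mul_le_mul_right h' hpos



/-! ### Corollary: the bound on `A(n,d)` -/

/-- The support of a `0/1` word: the identification `{0,1}^n = 2^[n]` used throughout. [cite: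
Laurent2006, §2.1 p. 244 (P = the collection of subsets of [n] ≅ {0,1}^n); auxiliary] -/
def wordSupport (u : Fin n → Bool) : Finset (Fin n) := univ.filter fun i => u i = true

/-- [cite: Laurent2006, §2.1 p. 244 (auxiliary)] -/
theorem wordSupport_injective : Function.Injective (wordSupport (n := n)) := by
  intro u v h
  funext i
  have hi : i ∈ wordSupport u ↔ i ∈ wordSupport v := by rw [h]
  simp only [wordSupport, mem_filter, mem_univ, true_and] at hi
  cases hu : u i <;> cases hv : v i <;> simp_all

/-- Hamming distance = size of the symmetric difference of the supports. [cite: Laurent2006, §2.1 p.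
244 ("the Hamming distance … is |I ∆ J|"); auxiliary] -/
theorem card_wordSupport_symmDiff (u v : Fin n → Bool) :
    #(wordSupport u ∆ wordSupport v) = hammingDist u v := by
  rw [hammingDist]
  congr 1
  ext i
  simp only [wordSupport, mem_symmDiff, mem_filter, mem_univ, true_and, ne_eq]
  cases u i <;> cases v i <;> simp

/-- **Schrijver's semidefinite programming bound for `A(n,d)`** (certificate form): if `B`
bounds the objective on Schrijver's feasible region then `A(n,d) ≤ B`.
[cite: Schrijver2005, main theorem (A(n,d) ≤ the SDP optimum); Gijswijt2010 Ch. 4 §2 Thm. 6 (q = 2)]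
-/
theorem maxCodeSize_le_of_schrijverBound {d B : ℕ}
    (hB : ∀ x : ℕ × ℕ × ℕ → ℤ, SchrijverFeasible n d x →
      ∑ k ∈ range (n + 1), (n.choose k : ℤ) * x (0, k, 0) ≤ B * x (0, 0, 0)) :
    maxCodeSize n d ≤ B := by
  obtain ⟨C, hC, hcard⟩ := exists_code_card_eq_maxCodeSize n d
  rw [← hcard, ← card_image_of_injective C wordSupport_injective]
  refine card_le_of_schrijverBound hB _ fun u hu v hv huv => ?_
  obtain ⟨u', hu', rfl⟩ := mem_image.1 hu
  obtain ⟨v', hv', rfl⟩ := mem_image.1 hv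
  rw [card_wordSupport_symmDiff]
  exact hC (mem_coe.2 hu') (mem_coe.2 hv') fun h => huv (by rw [h])

end Literature.InformationTheory.Coding
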